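import Summits.ABC.ABC.Theorems.IsogenyGlueCongruenceTorsionSharingLine
import Literature.NumberTheory.EllipticCurves.LFunctionCoefficientBound
import Literature.NumberTheory.DiophantineGeometry.PastenValuationProductsProofs
import HarnessLib

/-!
# Crux K `TorsionSharingPrimeBound` (stmt-ABC-2157), line `SketchIdeator3g2` — stub `stub_levelRaise`

The level-raising piece `KLevelRaiseBound` of K (partner newform `g` of level `M` such that every
prime of `N = N_W` divides `M` and `M ≠ N`; `ℓ ≥ 11`, `ℓ ∤ M N`) from the bundle of printed inputs
`LevelMismatchFacts`, of which only (b) (level raising at `q ∥ M`, `q ∤ N`: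
`ℓ ∣ (q + 1)² - a_q(W)²`; Ribet / Diamond–Taylor) and (c) (Carayol at `q² ∣ M`: `ℓ ∣ q² - 1`) are
used, with `κ = 1`, `C = 4` (in print: `ℓ ≤ 4 M`).

Proof: `W` semistable makes `N` squarefree (`WeierstrassCurve.isSemistable_iff_squarefree_conductorNorm`),
so "every prime of `N` divides `M`" gives `N ∣ M`; as `M ≠ N`, `M = N t` with `t ≠ 1`, and a prime
`q ∣ t` divides `M`. If `q² ∣ M`, (c) gives `ℓ ∣ (q - 1)(q + 1)`, so `ℓ ≤ q + 1`. Otherwise `q ∤ N`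
(else `q² ∣ N t = M`), and (b) gives `ℓ ∣ (q + 1 - a)(q + 1 + a)` with `a = a_q(W)`; Hasse
(`WeierstrassCurve.abs_LFunction_prime_pow_le`, `|a| ≤ 2 √q`) gives `a² ≤ 4 q < (q + 1)²`, so both
factors are positive and `< 2 (q + 1)`, whence `ℓ ≤ 2 q + 1`. In all cases `ℓ ≤ 4 q ≤ 4 M`.
-/

noncomputable section

-- `Summit.ABC.ABC` is the mandated summit-side namespace (single-conjunct summit).
set_option linter.dupNamespace false

open Literature.NumberTheory.EllipticCurves.ModularForms
open Summit.ABC.ABC.Theses.IsogenyGlueCongruence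
open scoped MatrixGroups ModularForm
open CongruenceSubgroup

namespace Summit.ABC.ABC.Theorems.IGCTorsionSharing

/-- If every prime factor of a squarefree natural number `N` divides `M ≠ 0`, then `N ∣ M`. -/
private theorem dvd_of_squarefree_of_forall_prime_dvd {M N : ℕ} (hM0 : M ≠ 0)
    (hN : Squarefree N) (h : ∀ p : ℕ, p.Prime → p ∣ N → p ∣ M) : N ∣ M := by
  have hN0 : N ≠ 0 := hN.ne_zero
  have hN1 := (Nat.squarefree_iff_factorization_le_one hN0).mp hN
  refine (Nat.factorization_le_iff_dvd hN0 hM0).mp fun p ↦ ?_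
  by_cases hp : p.Prime
  · by_cases hpN : p ∣ N
    · exact (hN1 p).trans (hp.factorization_pos_of_dvd hM0 (h p hp hpN))
    · rw [Nat.factorization_eq_zero_of_not_dvd hpN]
      exact Nat.zero_le _
  · rw [Nat.factorization_eq_zero_of_not_prime _ hp]
    exact Nat.zero_le _

/-- A prime `ℓ` dividing `(q + 1)² - a²` in `ℤ`, where `2 ≤ q` and `a² ≤ 4 q`, satisfies
`ℓ ≤ 4 q` (both factors `q + 1 ∓ a` are positive and `< 2 (q + 1)`). -/
private theorem le_four_mul_of_dvd_sq_sub_sq {ℓ : ℕ} (hℓ : ℓ.Prime) {q a : ℤ} (hq : 2 ≤ q)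
    (ha : a ^ 2 ≤ 4 * q) (hdvd : (ℓ : ℤ) ∣ (q + 1) ^ 2 - a ^ 2) : (ℓ : ℤ) ≤ 4 * q := by
  have h1 : (1 : ℤ) ≤ q - 1 := by linarith
  have hlt : a ^ 2 < (q + 1) ^ 2 := by nlinarith [mul_le_mul h1 h1 zero_le_one (by linarith)]
  obtain ⟨hlo, hhi⟩ := abs_lt_of_sq_lt_sq' hlt (by linarith)
  have hfac : (q + 1) ^ 2 - a ^ 2 = (q + 1 - a) * (q + 1 + a) := by ring
  rw [hfac] at hdvd
  rcases (Nat.prime_iff_prime_int.mp hℓ).dvd_or_dvd hdvd with h | h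
  · have := Int.le_of_dvd (by linarith) h
    linarith
  · have := Int.le_of_dvd (by linarith) h
    linarith

/-- A prime `ℓ` dividing `q² - 1` in `ℤ`, where `2 ≤ q`, satisfies `ℓ ≤ 4 q` (indeed `ℓ ≤ q + 1`). -/
private theorem le_four_mul_of_dvd_sq_sub_one {ℓ : ℕ} (hℓ : ℓ.Prime) {q : ℤ} (hq : 2 ≤ q)
    (hdvd : (ℓ : ℤ) ∣ q ^ 2 - 1) : (ℓ : ℤ) ≤ 4 * q := by
  have hfac : q ^ 2 - 1 = (q - 1) * (q + 1) := by ring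
  rw [hfac] at hdvd
  rcases (Nat.prime_iff_prime_int.mp hℓ).dvd_or_dvd hdvd with h | h
  · have := Int.le_of_dvd (by linarith) h
    linarith
  · have := Int.le_of_dvd (by linarith) h
    linarith

/-- **Hasse at a prime, squared**: `a_q(W)² ≤ 4 q` (from `|a_q(W)| ≤ 2 √q`,
`WeierstrassCurve.abs_LFunction_prime_pow_le` with `k = 1`). -/
private theorem sq_LFunction_prime_le (W : WeierstrassCurve ℚ) [W.IsElliptic] {q : ℕ}
    (hq : q.Prime) : (W.LFunction q : ℤ) ^ 2 ≤ 4 * (q : ℤ) := by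
  have habs : |((W.LFunction q : ℤ) : ℝ)| ≤ 2 * Real.sqrt q := by
    have h := W.abs_LFunction_prime_pow_le hq 1
    simp only [pow_one, Nat.cast_one] at h
    linarith
  have hs : Real.sqrt (q : ℝ) ^ 2 = q := Real.sq_sqrt (Nat.cast_nonneg q)
  have hR : ((W.LFunction q : ℤ) : ℝ) ^ 2 ≤ 4 * (q : ℝ) := by
    calc ((W.LFunction q : ℤ) : ℝ) ^ 2 = |((W.LFunction q : ℤ) : ℝ)| ^ 2 := (sq_abs _).symm
      _ ≤ (2 * Real.sqrt q) ^ 2 := pow_le_pow_left₀ (abs_nonneg _) habs 2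
      _ = 4 * (q : ℝ) := by rw [mul_pow, hs]; norm_num
  exact_mod_cast hR

/-- The printed level-mismatch inputs give the level-raising piece of K: a congruence prime
`ℓ ≥ 11`, `ℓ ∤ M N`, between `f_W` (`W` semistable of conductor `N`) and a newform of level
`M ≠ N` divisible by every prime of `N` satisfies `ℓ ≤ 4 M` (`κ = 1`, `C = 4`). -/
theorem stub_levelRaise : LevelMismatchFacts → KLevelRaiseBound := by
  intro hF
  obtain ⟨-, hFb, hFc, -⟩ := hF
  refine ⟨1, 4, zero_le_one, ?_⟩
  intro W _ _ _ hW M _ g hg _ ℓ hℓ hℓ11 hdiv hprimes hMN hcong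
  have hM0 : M ≠ 0 := NeZero.ne M
  -- `N` is squarefree, so `N ∣ M`; write `M = N t` with `t ≠ 1` and pick a prime `q ∣ t`
  have hsq : Squarefree (W.conductorNorm ℤ) := (W.isSemistable_iff_squarefree_conductorNorm).mp hW
  obtain ⟨t, ht⟩ := dvd_of_squarefree_of_forall_prime_dvd hM0 hsq hprimes
  have ht1 : t ≠ 1 := by
    rintro rfl
    exact hMN (by rw [ht, mul_one])
  obtain ⟨q, hq, hqt⟩ := Nat.exists_prime_and_dvd ht1
  have hqM : q ∣ M := by
    rw [ht]
    exact dvd_mul_of_dvd_right hqt _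
  have hq2 : (2 : ℤ) ≤ q := by exact_mod_cast hq.two_le
  -- `ℓ ≤ 4 q`
  have key : (ℓ : ℤ) ≤ 4 * (q : ℤ) := by
    by_cases hq2M : q ^ 2 ∣ M
    · -- (c): `ℓ ∣ q² - 1`
      exact le_four_mul_of_dvd_sq_sub_one hℓ hq2 (hFc W hW M g hg ℓ hℓ hℓ11 hdiv hcong q hq hq2M)
    · -- `q ∤ N` (else `q² ∣ N t = M`), so (b): `ℓ ∣ (q + 1)² - a_q(W)²`
      have hqN : ¬ q ∣ W.conductorNorm ℤ := by
        intro hqN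
        apply hq2M
        rw [sq, ht]
        exact mul_dvd_mul hqN hqt
      exact le_four_mul_of_dvd_sq_sub_sq hℓ hq2 (sq_LFunction_prime_le W hq)
        (hFb W hW M g hg ℓ hℓ hℓ11 hdiv hcong q hq hqM hq2M hqN)
  -- `ℓ ≤ 4 q ≤ 4 M = 4 M ^ 1`
  have hqM' : (q : ℤ) ≤ M := by exact_mod_cast Nat.le_of_dvd (Nat.pos_of_ne_zero hM0) hqM
  have hℓM : (ℓ : ℤ) ≤ 4 * (M : ℤ) := by linarith
  rw [Real.rpow_one]
  exact_mod_cast hℓM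

end Summit.ABC.ABC.Theorems.IGCTorsionSharing

end
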